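import Mathlib
import HarnessLib
import HarnessLib.Audit
import Summits.Schanuel.Statement
import Literature.ModelTheory.ExponentialFields.Languages
import Summits.Schanuel.Schanuel.Theorems.RigidCoreSchanuelOnLogFreeCoreSectorGlue
import Summits.Schanuel.Schanuel.Theorems.RigidCoreSchanuelOnLogFreeCoreSectorExactness
import Summits.Schanuel.Schanuel.Theorems.RigidCoreSchanuelOnLogFreeCoreExceptionalLineDichotomy
import HarnessLib.Audit.Status.Attr

/-!
Route: ExceptionalSubspaces

# Route ExceptionalSubspaces — exceptional subspaces — Schanuel = (π free from the
Lindemann–Weierstrass field) ∧ (Schanuel relative to ℚ(πi, ℚ̄, e^ℚ̄)); LW pigeonhole +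
exp-endomorphisms attack the first factor

It suffices to show X = PiFreeOverLWField ∧ RelSchanuelOverPiLWField — an EXACT factorisation of
Schanuel along the ℚ-subspace
V₂ = ℚ̄ ⊕ ℚπi (given Lindemann–Weierstrass, PROVED in the tree; Exactness: Schanuel ⇒ X, Assembly: X
⇒ Schanuel, both bookkeeping).
PiFreeOverLWField (the π–LW SECTOR, card exceptional-lines-conjugation-galois): for ℚ-linearly
independent algebraic a₁,…,a_d,
trdeg ℚ(π, e^{a₁},…,e^{a_d}) = d + 1 — π is transcendental over the Lindemann–Weierstrass field E =
ℚ(e^α : α ∈ ℚ̄); d = 1 is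
"π ⊥ e^α for every algebraic α ≠ 0" (contains e ⊥ π). RelSchanuelOverPiLWField (the honest
remainder, as OffLogSector in route
LogPatterns): Schanuel relative to K₂ = ℚ(πi, ℚ̄, e^ℚ̄) for tuples ℚ-independent modulo V₂. The
card's mechanism attacks the first
factor: the exceptional subspaces {A ⊂ ℚ̄ : π ∈ ℚ(e^A)^alg} are closed under intersection
(ExceptionalSubspacesIntersect, LW +
exchange), so a failure has a unique MINIMAL exceptional subspace A_π, stable under conj and under
every ring endomorphism of ℂ commuting
with exp; in dimension 1 this is the exceptional LINE, which EndomorphismCriterion kills as soon as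
one exp-endomorphism moves its
generator off {±α} (j = conj: ConjugationOffAxes, π ⊥ e^{a+bi} for ab ≠ 0, provable now),
GaloisOrbitRealised (KMO's orbit picture
for 𝔹, asked of ℂ) kills off the real-abelian line-type, and RealAbelianResidue (α² ∈ ℚ^{ab} ∩ ℝ ∋
1: e ⊥ π) is the arithmetic core.
Supersedes the retired instance route ExceptionalLines (same card; D-0027 §2.1: this route decides
the summit).
Lean: `(∀ (d : ℕ) (a : Fin d → ℂ), (∀ i, IsAlgebraic ℚ (a i)) → LinearIndependent ℚ a → ((d + 1 : ℕ)
: Cardinal) ≤ Algebra.trdeg ℚ ↥(IntermediateField.adjoin ℚ (insert (Real.pi : ℂ) (Set.range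
(Complex.exp ∘ a))))) ∧ (∀ (n : ℕ) (x : Fin n → ℂ), LinearIndependent ℚ ((Submodule.span ℚ ({z : ℂ |
IsAlgebraic ℚ z} ∪ {(Real.pi : ℂ) * Complex.I})).mkQ ∘ x) → (n : Cardinal) ≤ Algebra.trdeg
↥(IntermediateField.adjoin ℚ ({z : ℂ | IsAlgebraic ℚ z} ∪ {(Real.pi : ℂ) * Complex.I} ∪ Complex.exp
'' {z : ℂ | IsAlgebraic ℚ z})) ↥(IntermediateField.adjoin ↥(IntermediateField.adjoin ℚ ({z : ℂ |
IsAlgebraic ℚ z} ∪ {(Real.pi : ℂ) * Complex.I} ∪ Complex.exp '' {z : ℂ | IsAlgebraic ℚ z}))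
(Set.range x ∪ Set.range (Complex.exp ∘ x))))`

## Assembly
Bookkeeping, staffable now (L; the standard sector reduction, as in LogPatterns.Assembly,
AdelicLogSector.SchanuelOfSectors and the tree's
`Literature.NumberTheory.Transcendental.schanuelConjecture_iff_ecl_empty_holds`): given z ∈ ℂⁿ
ℚ-linearly independent, let
W = span_ℚ(z) ∩ V₂ (dim k) and change basis by P ∈ GL_n(ℚ) to (w, z′) with w a basis of W and z′
ℚ-independent modulo V₂ (trdeg ℚ(z, e^z)
= trdeg ℚ(Pz, e^{Pz}) since e^{(Pz)_i} is a radical monomial in the e^{z_j}); Schanuel on the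
V₂-tuple w holds by LW when πi ∉ W or
W = U ⊕ ℚ(πi + a₀) with a₀ ∉ U (then (u, a₀) is a ℚ-free algebraic family and LW alone gives trdeg ≥
k), and by PiFreeOverLWField when
πi ∈ W; then trdeg ℚ(z, e^z) ≥ trdeg ℚ(w, e^w) + trdeg_{K₂} K₂(z′, e^{z′}) ≥ k + (n − k) by the
tower law (relative trdeg can only
drop over the larger base K₂ ⊇ ℚ(w, e^w)) and RelSchanuelOverPiLWField. The DECIDING THEOREM
(glue.lean, kernel-checked):
`closes : Assembly → PiFreeOverLWField → … → Exactness → Schanuel := hAssembly hF1 hF2` — hypotheses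
= all 13 items, conclusion = `Schanuel`.

Rationale: WHY THIS LINE. Mechanism (card exceptional-lines-conjugation-galois = Diaz2009's
(doi:10.5802/jtnb.459) conjugation device run with Lindemann–Weierstrass
instead of Gel'fond–Schneider, joined to KirbyMacintyreOnshuus2012 = arXiv:1101.4224): by LW (tree
theorem
`Literature.NumberTheory.Transcendental.algebraicIndependent_exp_holds`) the exponentials of a
ℚ-basis of ℚ̄ are algebraically
independent, so "η is algebraic over ℚ(e^A)" behaves like a coordinate-subfield condition in a
purely transcendental extension:
exceptional subspaces intersect (exchange lemma), a transcendental anchor has at most ONE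
exceptional ℚ-line (pigeonhole), and a ring
endomorphism j of ℂ commuting with exp sends π to an odd multiple of π and the minimal exceptional
subspace to itself — so ONE
endomorphism moving α off {±α} proves π ⊥ e^α (EndomorphismCriterion), and j = conj already proves π
⊥ e^{a+bi}, ab ≠ 0
(ConjugationOffAxes; Diaz2009 Thm 5 / Prop. 1 / Thm 6 have the device with transcendence-only
outputs). Imported from model theory:
KMO's orbit analysis of Zilber's field (arXiv:1101.4224 Thm 2, §3.5 Prop., §3.7–3.8: Aut(𝔹) acts on
ℚ̄ as {σ : σ|ℚ^{ab} ∈ {1, σ₀}},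
fixed field ℚ^{ab} ∩ ℝ), which under Zilber's conjecture ℂ_exp ≅ 𝔹 (Zilber2005PseudoExp;
BaysKirby2018ANT Thm 1.4) makes
GaloisOrbitRealised true and pins the residual exceptional line to α² ∈ ℚ^{ab} ∩ ℝ — exactly the
classical hard cases α = 1, √d, i√d
(e ⊥ π "unknown": BaysKirby2018ANT §1); KMO's proposed 'Theorem 2 for ℂ_exp' (KMOTwoExistential)
gets an explicit transcendence price
tag (DefinabilityBridge: it implies π ⊥ e^{∛2}). To DECIDE the summit the sector is completed by its
exact complement (relative
Schanuel over K₂ = ℚ(πi, ℚ̄, e^ℚ̄)), the standard GL_n(ℚ)-split used by LogPatterns /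
AdelicLogSector and by the tree's
`schanuelConjecture_iff_ecl_empty_holds`; what this line does that RigidCore (symmetry ⇒
transcendence in the LOG sector over acl(∅),
Baker hinges) and LogPatterns/AdelicLogSector (log sectors) do not: it isolates the LW sector, where
the hinge is PROVED, unconditional
instances drop out now, and symmetry still acts INSIDE Kirby's core (∛2 ∈ ℚ̄ ⊂ C_EA is not
∅-definable conjecturally) — a refinement
of RigidCore's 'arithmetic side'. Considered and not used at open: E-function anchors (card F4) and
trdeg-2 anchors (Nesterenko1996) —
layer 2; probabilistic or physical analogies — none with a dictionary.

RANKED CRUXES. #2 PiFreeOverLWField (crux) — the π–LW sector (Factor 1): for every d and every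
ℚ-linearly independent family of algebraic numbers a₁,…,a_d, trdeg_ℚ ℚ(π, e^{a₁},…,e^{a_d}) ≥ d + 1,
i.e. π is transcendental over the Lindemann–Weierstrass field E = ℚ(e^α : α algebraic) (Schanuel at
(πi, a₁,…,a_d); d = 0 is Lindemann, d = 1 is π ⊥ e^α for all algebraic α ≠ 0, PROVED off ℝ ∪ iℝ by
ConjugationOffAxes). Equivalently: π has no exceptional subspace. Its d = 1 layer is decomposed now
(DOneGlue: EndomorphismCriterion + GaloisOrbitRealised + RealAbelianResidue); d ≥ 2 has only the
structural handle ExceptionalSubspacesIntersect (the minimal exceptional subspace is unique and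
symmetric). [difficulty: open-problem] (why it might fail: Contains e ⊥ π (d = 1) and π ∉ ℚ(e,
e^{√2})^alg; for d ≥ 2 symmetry only transports the minimal exceptional subspace, it does not kill
it, and no method relates π to two exponentials; false iff π is algebraic over some
ℚ(e^{a₁},…,e^{a_d}).) [Waldschmidt2000, BaysKirby2018ANT, MarquesSondow2010, doi:10.5802/jtnb.459]
#3 GaloisOrbitRealised (crux) — for every algebraic α with α² ∉ ℚ^{ab} ∩ ℝ there is a ring
endomorphism j of ℂ commuting with exp and moving α off {α, −α} (card C1/C2 in endomorphism form).
For α ∉ ℝ ∪ iℝ, j = conj works (theorem); the content is α ∈ ℝ ∪ iℝ: ∛2, i∛2, 2^{1/6}, … Under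
Zilber's conjecture ℂ_exp ≅ 𝔹 it holds with j an automorphism (KMO §3.5 Prop. + §3.7: Aut(𝔹)|ℚ̄ = {σ
: σ|ℚ^{ab} ∈ {1, σ₀}}, fixed field ℚ^{ab} ∩ ℝ). Not implied by Schanuel. With EndomorphismCriterion
it settles the d = 1 layer of PiFreeOverLWField off the real-abelian line-type (DOneGlue).
[difficulty: open-problem] (why it might fail: No exponential-ring endomorphism of ℂ besides id and
conj is known (Mycielski's question; KMO p.2, §3.10); realising a prescribed Galois action needs
KMO's extension property over SK, open for ℂ even under SC; false if End(ℂ_exp) = {id, conj}.)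
[arXiv:1101.4224, KirbyMacintyreOnshuus2012, Kirby2013FPEF, Zilber2005PseudoExp, BaysKirby2018ANT,
arXiv:2209.01027]
#4 RealAbelianResidue (crux) — π ⊥ e^α for every nonzero algebraic α whose square is real-abelian
(α² ∈ ℚ^{ab} ∩ ℝ, i.e. α = ±√c with c ∈ ℚ(ζ_n) ∩ ℝ): the residual exceptional line-type that no
exponential-ring endomorphism of ℂ can move (every one maps 2πi to ±2πi, acts on roots of unity by ζ
↦ ζ^{±1}, so fixes ℚ^{ab} ∩ ℝ pointwise and jα = ±α exactly when α² ∈ ℚ^{ab} ∩ ℝ); it contains α = 1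
(e ⊥ π), √2, i, i√3, 2cos(2π/7). By ExceptionalLineDichotomy at most ONE ℚ-line inside it fails.
Card: 'the irreducible arithmetic core' of the d = 1 layer. [difficulty: open-problem] (why it might
fail: Contains e ⊥ π ('unknown', BaysKirby2018ANT §1) and π ⊥ e^i; every symmetry of ℂ_exp fixes α²,
so only arithmetic input can decide it and no method separates π from a single e^α today; false iff
some P(π, e^{√c}) = 0.) [BaysKirby2018ANT, Waldschmidt2000, arXiv:1101.4224, MarquesSondow2010]
#5 RelSchanuelOverPiLWField (crux) — the exact complement (Factor 2): for x₁,…,x_n ∈ ℂ ℚ-linearly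
independent modulo V₂ = span_ℚ(ℚ̄ ∪ {πi}) = ℚ̄ ⊕ ℚπi, the transcendence degree of K₂(x, e^x) over K₂
= ℚ(ℚ̄ ∪ {πi} ∪ e^ℚ̄) is at least n — Schanuel relative to the field of the π–LW sector (same shape
as LogPatterns.OffLogSector / AdelicLogSector.OffPrimeLogSector, with which it shares all tuples off
the log lattice). Implied by Schanuel (Exactness: finite-coefficient descent K₂ → ℚ(w, e^w) for a
finite-dimensional W ∋ πi, then Schanuel at (w, x) and the tower law, using trdeg ℚ(w, e^w) ≤ dim W
on V₂). [difficulty: open-problem] (why it might fail: It is Schanuel off the π–LW sector verbatim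
(contains π ⊥ log 2 over K₂, AlgIndepLogarithms, e ⊥ e^e relative to K₂); no mechanism of this route
touches it — the honest remainder of an exact factorisation; false iff Schanuel fails for a tuple
independent mod ℚ̄ ⊕ ℚπi.) [Waldschmidt2000, Kirby2010EAEF, Lang1966, BaysKirby2018ANT]
#6 KMOTwoExistential (crux) — KMO's 'Theorem 2 for ℂ_exp', existential fragment (card C2): an
algebraic number pointwise definable in (ℂ, +, ·, exp) by an EXISTENTIAL formula without parameters
is real-abelian (∈ ℚ^{ab} ∩ ℝ). KMO prove Thm 1 (all real-abelian numbers ARE pointwise definable,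
in ℂ_exp too) and Thm 2 (the converse) for Zilber fields, and name 'Theorem 2 for ℂ_exp' as the step
towards Zilber's conjecture they could not make 'even assuming Schanuel's Conjecture'.
DefinabilityBridge converts it into π ⊥ e^α for all algebraic α with α² ∉ ℚ^{ab} ∩ ℝ — an
alternative to GaloisOrbitRealised for the symmetric part of the d = 1 layer and the transcendence
price tag explaining its resistance. [difficulty: open-problem] (why it might fail: Via
DefinabilityBridge it implies π ⊥ e^{∛2}, so it is at least a new transcendence theorem; no
non-definability technique for ℂ_exp avoiding automorphisms exists (KMO p.2); false iff some α ∉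
ℚ^{ab}∩ℝ (e.g. the real ∛2) has a parameter-free ∃-definition.) [arXiv:1101.4224,
KirbyMacintyreOnshuus2012, Marker2006, Kirby2013FPEF]
#9 EndomorphismCriterion (support) — provable now (~400 lines over the tree's
`Literature.NumberTheory.Transcendental.algebraicIndependent_exp_holds` and
`transcendental_pi_holds`): if α is algebraic and a ring endomorphism j of ℂ with j ∘ exp = exp ∘ j
has jα ∉ {α, −α}, then π and e^α are algebraically independent. Proof: j(i) = ±i and e^{j(πi)} =
j(−1) = −1 give j(π) = mπ with m odd; a relation P(π, e^α) = 0 over ℚ transports to P(mπ, e^{jα}) =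
0, so e^α and e^{jα} are both algebraic over ℚ(π) (π, mπ transcendental ⇒ P(π,Y), P(mπ,Y) ≢ 0); if
(α, jα) is ℚ-free, LW makes e^α, e^{jα} algebraically independent — impossible inside trdeg 1; else
jα = qα with q ∈ ℚ∖{0, ±1} and the jⁿα = qⁿα are infinitely many roots of the minimal polynomial of
α. The LW-sector twin of RigidCore.EndomorphismMovingLogTwo. [difficulty: provable-now]
[BakerTNT1975, doi:10.5802/jtnb.459, arXiv:1101.4224,
Literature.NumberTheory.Transcendental.algebraicIndependent_exp_holds]
#9 ConjugationOffAxes (support) — THEOREM F2 of the card, provable now (~200 lines, LW + conj): for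
a transcendental η ∈ ℝ ∪ iℝ and an algebraic α with Re α ≠ 0 and Im α ≠ 0, η and e^α are
algebraically independent (instances: π ⊥ e^{1+i}; log 2 ⊥ e^{1+i}; trdeg ℚ(e^e, e^{1+i}) = trdeg
ℚ(e^e) + 1). Proof: P(η, e^α) = 0 conjugates to P(±η, e^{ᾱ}) = 0, so e^α, e^ᾱ are algebraic over
ℚ(η), trdeg 1, while (α, ᾱ) is ℚ-free and LW gives trdeg ℚ(e^α, e^ᾱ) = 2. Same Lean statement as
card conjugation-discount-sigma-stable-core (R1) would file — filed once here (ledger dedup). At η =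
π it is EndomorphismCriterion at j = conj (kernel-checked in the planner sketch). [difficulty:
provable-now] [doi:10.5802/jtnb.459, BakerTNT1975, Waldschmidt2000,
Literature.NumberTheory.Transcendental.algebraicIndependent_exp_holds]
#9 ExceptionalLineDichotomy (support) — F1 of the card, provable now (~150 lines): for a
transcendental anchor η and ℚ-linearly independent algebraic α, β, at least one of the pairs (η,
e^α), (η, e^β) is algebraically independent — the exceptional exponents of an anchor span at most
one ℚ-line (LW: e^α, e^β algebraically independent cannot both be algebraic over ℚ(η)); the
dimension-1 case of ExceptionalSubspacesIntersect. At η = π, unconditionally: at least one of e ⊥ π,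
π ⊥ e^{√2}; at least one of e ⊥ π, π ⊥ e^{i}. [difficulty: provable-now] [BakerTNT1975,
doi:10.5802/jtnb.459, Literature.NumberTheory.Transcendental.algebraicIndependent_exp_holds]
#9 ExceptionalSubspacesIntersect (support) — the card's exceptional-SUBSPACE formalism as a theorem,
provable now (M): for any η ∈ ℂ and ℚ-subspaces A, B of ℚ̄ ⊂ ℂ, if η is algebraic over ℚ(e^A) and
over ℚ(e^B) then η is algebraic over ℚ(e^{A ∩ B}). Proof: extend a ℚ-basis of A ∩ B to bases of A
and of B; the union is ℚ-independent in A + B, so by LW its exponentials form an algebraically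
independent set S ⊇ S_A, S_B with S_A ∩ S_B = S_{A∩B}; ℚ(e^A) is algebraic over ℚ(S_A) (e^{qa} is a
radical of e^a); and for subsets of an algebraically independent set ℚ(S_A)^alg ∩ ℚ(S_B)^alg = ℚ(S_A
∩ S_B)^alg (exchange). Consequences: if η is algebraic over the LW field there is a unique MINIMAL
exceptional subspace A_η (finite-dimensional), stable under conj when η ∈ ℝ ∪ iℝ and, for η = π,
under the ℚ̄-action of every ring endomorphism of ℂ commuting with exp (j(π) = mπ);
PiFreeOverLWField ⟺ A_π does not exist; dim A_π = 1 is the regime of ExceptionalLineDichotomy /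
EndomorphismCriterion. [difficulty: M] [BakerTNT1975, Lang1966,
Literature.NumberTheory.Transcendental.algebraicIndependent_exp_holds]
#9 DefinabilityBridge (support) — provable now (L; first-order bookkeeping over Mathlib's
`FirstOrder.Language.BoundedFormula.IsExistential` / `Formula.Realize` and the tree's
`Language.expRing` structure on ℂ): KMOTwoExistential ⇒ π ⊥ e^α for every algebraic α with α² ∉
ℚ^{ab} ∩ ℝ. Proof (card F3): if P(π, e^{α₀}) = 0, the existential formula φ(a) := m_{α₀}(a) = 0 ∧ ∃z
∃w (E(z) + 1 = 0 ∧ w·w + 1 = 0 ∧ P(w·z, E(a)) = 0) holds of α₀ (z = πi, w = −i) and only of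
conjugates β with e^β algebraic over ℚ(π) (w·z = ±(2k+1)π is transcendental), hence by
ExceptionalLineDichotomy only of β ∈ ℚα₀ ∩ {conjugates of α₀} = {±α₀} (β = qα₀ conjugate ⇒ qⁿα₀
conjugates for all n ⇒ q = ±1); so ∃a (φ(a) ∧ x = a·a) is a parameter-free ∃-definition of α₀², and
KMOTwoExistential puts α₀² in ℚ^{ab} ∩ ℝ. [difficulty: L] [arXiv:1101.4224,
KirbyMacintyreOnshuus2012, BakerTNT1975]
#9 DOneGlue (support) — the d = 1 layer of PiFreeOverLWField from the two d = 1 cruxes, pure logic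
(kernel-checked in the planner sketch, axioms propext / Classical.choice / Quot.sound): given
EndomorphismCriterion, GaloisOrbitRealised and RealAbelianResidue, π ⊥ e^α for every nonzero
algebraic α (if α² is real-abelian use the residue, else the realised orbit and the criterion). The
Cardinal form '2 ≤ trdeg ℚ(π, e^α)' of the d = 1 instance is a later split glue. [difficulty:
provable-now] [arXiv:1101.4224, doi:10.5802/jtnb.459]
#9 Exactness (support) — the factorisation loses nothing, provable now (L): Schanuel ⇒
PiFreeOverLWField (Schanuel at (πi, a₁,…,a_d), ℚ-free because π is transcendental; e^{πi} = −1 and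
i, a_j algebraic, so trdeg ℚ(π, e^a) ≥ d + 1) and Schanuel ⇒ RelSchanuelOverPiLWField (if trdeg_{K₂}
K₂(x, e^x) < n, the finitely many algebraic dependences over K₂ have coefficients in ℚ(w, e^w) for a
basis w of some finite-dimensional W ⊂ V₂ containing πi; (w, x) is ℚ-free, Schanuel gives trdeg ℚ(w,
x, e^w, e^x) ≥ dim W + n while trdeg ℚ(w, e^w) ≤ dim W on V₂ — tower law, contradiction). Hence X ⟺
Schanuel. [difficulty: L] [Waldschmidt2000, Kirby2010EAEF,
Literature.NumberTheory.Transcendental.schanuelConjecture_iff_ecl_empty_holds]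

TWO-LAYER PLAN. Foreseen glued splits (nothing filed now): PiFreeOverLWField ⇐ DOne → DHigher →
PiFreeOverLWField, where DOne (d ≤ 1: '2 ≤ trdeg ℚ(π, e^α)')
follows from the rank-3/4 cruxes by DOneGlue + EndomorphismCriterion, and DHigher (d ≥ 2: no minimal
exceptional subspace of dimension ≥ 2)
is attacked through ExceptionalSubspacesIntersect (A_π is an H-stable ℚ-subspace of ℚ̄ once Galois
orbits are realised); RealAbelianResidue ⇐
RealAxisResidue → ImaginaryAxisResidue → RealAbelianResidue; GaloisOrbitRealised ⇐
ExoticEndomorphism (∃ an exp-endomorphism of ℂ other than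
id, conj) → OrbitFromHomogeneity → GaloisOrbitRealised, or its countable-core version (endomorphisms
of ecl(∅) suffice for the criterion);
RelSchanuelOverPiLWField ⇐ LogSector-type items shared with LogPatterns / AdelicLogSector (ledger
dedup) → the rest.

KILL CRITERIA. RelSchanuelOverPiLWField or PiFreeOverLWField refuted (a tuple with trdeg too small)
refutes Schanuel: close `refuted:<Decl>` and every route
on this summit learns the witness. A proof that every exponential-ring endomorphism of ℂ is
continuous refutes GaloisOrbitRealised and voids
the symmetric attack on the d = 1 layer: pivot to DefinabilityBridge if KMOTwoExistential survives,
else restate the d = 1 layer as pure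
arithmetic (drop GaloisOrbitRealised; the route survives as the factorisation + unconditional
supports, grade falls to 'variant').
A parameter-free ∃-definition of a non-real-abelian algebraic number refutes KMOTwoExistential (and
Zilber's conjecture): drop it.
PiFreeOverLWField proved elsewhere leaves the route = RelSchanuelOverPiLWField, i.e. superseded by
LogPatterns-type routes: close `superseded`.

NOT DECOMPOSED YET. d ≥ 2 of the sector (DHigher) beyond the structural theorem; the countable-core
versions of GaloisOrbitRealised (endomorphisms of ecl(∅) as
an E-field; needs the `Kirby2010_ecl_isExpSubfield` API); the transfer ZilberConjecture →
GaloisOrbitRealised (KMO's extension Proposition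
as a named fact + transport along ℂ ≅ 𝔹); positive-∃ vs ∃ fragments of KMOTwoExistential; the axis
split of the residue; the quantitative
version (a measure of algebraic independence of (π, e^α) from an LW measure by a resultant, card
S4); other anchors (η ∈ ℝ ∪ iℝ
transcendental: the supports are already anchor-free; trdeg-2 anchor fields Nesterenko1996 /
Chudnovsky1984; the E-function storey, card F4)
— all layer 2 or support, filed when a crux moves. RelSchanuelOverPiLWField is deliberately NOT
decomposed here (other routes own it).

CHEAPEST FALSIFIER. (0) Paper check of the factorisation (15 min): Exactness (finite-coefficient
descent + Schanuel at (w, x)) and Assembly (GL_n(ℚ) split;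
the case W = U ⊕ ℚ(πi + a₀), a₀ ∉ U is LW alone) — a gap here kills the route's conformance, not its
mathematics. (1) Lookup: is
ConjugationOffAxes or the endomorphism criterion already in print — Waldschmidt GL326
(Waldschmidt2000) Ex. 15.16 and pp. 15, 399, 614,
which Diaz2009 p. 551 cites for 'conjectures with modulus or conjugation' (Diaz2009 READ this
session, pp. 7, 16–18: not there; GL326 not
held)? A hit turns supports into citations and the grade into 'variant'; nothing is refuted. (2) For
KMOTwoExistential: try to write a
parameter-free ∃-definition of the real ∛2 in ℂ_exp from Laczkovich's ∃-definition of ℤ (KMO §2.2);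
success kills it and Zilber's conjecture.

NUMBERS. Known: α ∉ ℝ ∪ iℝ algebraic ⇒ π ⊥ e^α (this route, provable now from LW); α ∈ ℝ ∪ iℝ, α ≠
0: open for EVERY α (e ⊥ π 'unknown',
BaysKirby2018ANT §1); d ≥ 2: nothing beyond Lindemann–Weierstrass. Exceptional ℚ-lines per
transcendental anchor: ≤ 1; exceptional
subspaces closed under ∩ (this route). KMO (arXiv:1101.4224): real-abelian numbers pointwise
definable in every E-field with cyclic kernel
(Thm 1, proved for ℂ_exp); in 𝔹 nothing else is (Thm 2); Aut(𝔹)-orbit of an algebraic number is a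
singleton iff it is real-abelian
(§3.8). Known exponential-ring endomorphisms of ℂ: 2 (id, conj). Items at open: 13 (5 cruxes, 7
supports, 1 assembly).

DEFINITION REQUESTS. `realAbelianNumbers : IntermediateField ℚ ℂ` (KMO's ℚ^{abℝ} = ℚ(all roots of
unity) ∩ ℝ, arXiv:1101.4224 §2.1) toward
Literature/ModelTheory/ExponentialFields, to replace the inline `(·).im = 0 ∧ ∃ n, 0 < n ∧ · ∈
IntermediateField.adjoin ℚ {exp(2πi/n)}`;
`piLWField : IntermediateField ℚ ℂ` (K₂ = ℚ(πi, ℚ̄, e^ℚ̄)) and `piLWSpan : Submodule ℚ ℂ` (V₂)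
toward Summits/Schanuel/Schanuel/Theorems
if provers want named abbreviations; cite fact wanted: KMO §3.5 Proposition + §3.8 (in a Zilber
field with CCP every automorphism of a
finitely generated strong partial E-subfield containing SK extends; singleton Aut-orbit iff
real-abelian).

Novelty: Searches (2026-08-15): `lit read arXiv:1101.4224` (KMO; READ pp. 2–3, 6–8: Thm 1, Thm 2, §2.1–2.4,
§3.5 Prop., §3.7–3.10);
`lit read doi:10.5802/jtnb.459` (Diaz2009; READ pp. 7, 16–18: Thm 5 'HL from Gel'fond–Schneider up
to one exception', §5 Conj. C(|u|),
Prop. 1 via conjugation, Conj. C(u₁,u₂), Thm 6); `lit galaxy search --star all` "automorphism of the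
complex exponential field" (0 rows),
"exponential field automorphism" (0), "complex exponential field" (11 rows: Pila ZP tract, van den
Dries et al. LNM 2111, Baldwin;
pdf: Edmundo–Terzo free E-subrings, D'Aquino–Macintyre–Terzo Schanuel Nullstellensatz,
D'Aquino–Fornasiero–Terzo iterated exponentials,
Mariaule p-adic — none on conjugation/LW instances or on definable algebraic numbers in ℂ_exp); `lit
frontier Schanuel --since 2020`
(30 rows: Zilber–Pink, E- /Э-values, zeta values, Hensel minimality — nothing on symmetries of
ℂ_exp); `lit bridges Schanuel --cross any`
(30 rows, none relevant); all Schanuel route files (nearest: RigidCore; the sector-factorisation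
pattern of LogPatterns / AdelicLogSector
reused for conformance); `lit search` ×3 → searchd rc 75 this session (searched-but-not-exhaustive;
the card's own searches and
refuter-triage-16's reading of Diaz stand). Nearest prior art found: Diaz2009 = doi:10.5802/jtnb.459
(conjugation + one-exception sets,
engines Gel'fond–Schneider / six exponentials, transcendence statements only);
KirbyMacintyreOnshuus2012 = arXiv:1101.4224 Thm 2 and
§3.8 (orbits of algebraic number  [refs: 10.5802/jtnb.459`, 10.5802/jtnb.459, 1101.4224, 0912.4019, doi:10.5802/jtnb.459, KirbyMacintyreOnshuus2012]

Barriers (technique_class: conjugation-symmetry LW-pigeonhole definability): - technique_class: conjugation-symmetry LW-pigeonhole definability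
- Literature.Barriers.Schanuel.AxiomsDoNotForceSchanuel: respected — no axioms-to-SP transfer; the
route derives INSTANCES of Schanuel from the existence of specific endomorphisms of the one
structure ℂ_exp plus Lindemann–Weierstrass, isolates the part no symmetry can reach as an explicitly
arithmetic crux (RealAbelianResidue), and carries the rest of the summit as a named
relative-Schanuel crux; Bays–Kirby's SP-free quasiminimal fields are consistent with this split
(their failures sit in a definable finite-dimensional core, the analogue of the residue).
- Literature.Barriers.Schanuel.SchanuelPropertyNotFirstOrder: no first-order axiomatisation or
transfer between models is used; KMOTwoExistential quantifies over ∃-formulas evaluated in ℂ itself,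
and endomorphisms enter only through preservation of exp, of ℚ and of polynomial relations.
- Literature.Barriers.Schanuel.AlgebraicIndependenceOfLogarithms: evaded by sector — every output of
the mechanism is independence of π from e^α with α ALGEBRAIC, where Lindemann–Weierstrass gives full
algebraic independence and the pigeonhole costs nothing; the logarithms live entirely inside the
remainder crux RelSchanuelOverPiLWField, about which this route proves nothing (the exceptional set
{β : log β ∈ ℚ(π)^alg} is a group of unbounded rank precisely because AlgIndepLogarithms is open —
the recorded reason the trick stops at the log sector, RigidCore's / LogPatterns' ter

sub-problem: Schanuel · status: done · opened planner-plancard-Schanuel-Schanuel-exceptiona-7c4b660f-0 2026-08-15T14:00:58Z · rev 0 · ledger route-Schanuel-ExceptionalSubspaces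
GENERATED by the gate from the ledger (D-0016/17). Provers cite these decls: `theorem foo : Summit.Schanuel.Schanuel.Theses.ExceptionalSubspaces.<Decl> := …` in Summits/Schanuel/Schanuel/Theorems/<Name>.lean.
-/

namespace Summit.Schanuel.Schanuel.Theses.ExceptionalSubspaces

open scoped BigOperators Topology Manifold Classical MeasureTheory ProbabilityTheory Matrix InnerProductSpace ComplexConjugate ContinuousMap
open Filter Set Function TopologicalSpace MeasureTheory

attribute [summit_statement] _root_.Schanuel

open Literature.Periods

/-- item stmt-Schanuel-9545 · crux · rank 2 · open · by planner
why it might fail: Contains e ⊥ π (d = 1) and π ∉ ℚ(e, e^{√2})^alg; for d ≥ 2 symmetry only transports the minimal exceptional subspace, it does not kill it, and no method relates π to two exponentials; false iff π is algebraic over some ℚ(e^{a₁},…,e^{a_d}).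
sources: Waldschmidt2000, BaysKirby2018ANT, MarquesSondow2010, doi:10.5802/jtnb.459
[crux] the π–LW sector (Factor 1): for every d and every ℚ-linearly independent family of algebraic
numbers a₁,…,a_d, trdeg_ℚ ℚ(π, e^{a₁},…,e^{a_d}) ≥ d + 1, i.e. π is transcendental over the
Lindemann–Weierstrass field E = ℚ(e^α : α algebraic) (Schanuel at (πi, a₁,…,a_d); d = 0 is
Lindemann, d = 1 is π ⊥ e^α for all algebraic α ≠ 0, PROVED off ℝ ∪ iℝ by ConjugationOffAxes).
Equivalently: π has no exceptional subspace. Its d = 1 layer is decomposed now (DOneGlue: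
EndomorphismCriterion + GaloisOrbitRealised + RealAbelianResidue); d ≥ 2 has only the structural
handle ExceptionalSubspacesIntersect (the minimal exceptional subspace is unique and symmetric).
[difficulty: open-problem] -/
@[route_item "route-Schanuel-ExceptionalSubspaces", crux]
def PiFreeOverLWField : Prop :=
  ∀ (d : ℕ) (a : Fin d → ℂ), (∀ i, IsAlgebraic ℚ (a i)) → LinearIndependent ℚ a → ((d + 1 : ℕ) : Cardinal) ≤ Algebra.trdeg ℚ ↥(IntermediateField.adjoin ℚ (insert (Real.pi : ℂ) (Set.range (Complex.exp ∘ a))))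

/-- item stmt-Schanuel-9546 · crux · rank 3 · open · by planner
why it might fail: No exponential-ring endomorphism of ℂ besides id and conj is known (Mycielski's question; KMO p.2, §3.10); realising a prescribed Galois action needs KMO's extension property over SK, open for ℂ even under SC; false if End(ℂ_exp) = {id, conj}.
sources: arXiv:1101.4224, KirbyMacintyreOnshuus2012, Kirby2013FPEF, Zilber2005PseudoExp, BaysKirby2018ANT, arXiv:2209.01027
[crux] for every algebraic α with α² ∉ ℚ^{ab} ∩ ℝ there is a ring endomorphism j of ℂ commuting with
exp and moving α off {α, −α} (card C1/C2 in endomorphism form). For α ∉ ℝ ∪ iℝ, j = conj works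
(theorem); the content is α ∈ ℝ ∪ iℝ: ∛2, i∛2, 2^{1/6}, … Under Zilber's conjecture ℂ_exp ≅ 𝔹 it
holds with j an automorphism (KMO §3.5 Prop. + §3.7: Aut(𝔹)|ℚ̄ = {σ : σ|ℚ^{ab} ∈ {1, σ₀}}, fixed
field ℚ^{ab} ∩ ℝ). Not implied by Schanuel. With EndomorphismCriterion it settles the d = 1 layer of
PiFreeOverLWField off the real-abelian line-type (DOneGlue). [difficulty: open-problem] -/
@[route_item "route-Schanuel-ExceptionalSubspaces", crux]
def GaloisOrbitRealised : Prop :=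
  ∀ α : ℂ, IsAlgebraic ℚ α → ¬ ((α ^ 2).im = 0 ∧ ∃ n : ℕ, 0 < n ∧ α ^ 2 ∈ IntermediateField.adjoin ℚ ({Complex.exp (2 * Real.pi * Complex.I / n)} : Set ℂ)) → ∃ j : ℂ →+* ℂ, (∀ z : ℂ, j (Complex.exp z) = Complex.exp (j z)) ∧ j α ≠ α ∧ j α ≠ -α

/-- item stmt-Schanuel-9547 · crux · rank 4 · open · by planner
why it might fail: Contains e ⊥ π ('unknown', BaysKirby2018ANT §1) and π ⊥ e^i; every symmetry of ℂ_exp fixes α², so only arithmetic input can decide it and no method separates π from a single e^α today; false iff some P(π, e^{√c}) = 0.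
sources: BaysKirby2018ANT, Waldschmidt2000, arXiv:1101.4224, MarquesSondow2010
[crux] π ⊥ e^α for every nonzero algebraic α whose square is real-abelian (α² ∈ ℚ^{ab} ∩ ℝ, i.e. α =
±√c with c ∈ ℚ(ζ_n) ∩ ℝ): the residual exceptional line-type that no exponential-ring endomorphism
of ℂ can move (every one maps 2πi to ±2πi, acts on roots of unity by ζ ↦ ζ^{±1}, so fixes ℚ^{ab} ∩ ℝ
pointwise and jα = ±α exactly when α² ∈ ℚ^{ab} ∩ ℝ); it contains α = 1 (e ⊥ π), √2, i, i√3,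
2cos(2π/7). By ExceptionalLineDichotomy at most ONE ℚ-line inside it fails. Card: 'the irreducible
arithmetic core' of the d = 1 layer. [difficulty: open-problem] -/
@[route_item "route-Schanuel-ExceptionalSubspaces", crux]
def RealAbelianResidue : Prop :=
  ∀ α : ℂ, IsAlgebraic ℚ α → α ≠ 0 → ((α ^ 2).im = 0 ∧ ∃ n : ℕ, 0 < n ∧ α ^ 2 ∈ IntermediateField.adjoin ℚ ({Complex.exp (2 * Real.pi * Complex.I / n)} : Set ℂ)) → AlgebraicIndependent ℚ ![(Real.pi : ℂ), Complex.exp α]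

/-- item stmt-Schanuel-9548 · crux · rank 5 · open · by planner
why it might fail: It is Schanuel off the π–LW sector verbatim (contains π ⊥ log 2 over K₂, AlgIndepLogarithms, e ⊥ e^e relative to K₂); no mechanism of this route touches it — the honest remainder of an exact factorisation; false iff Schanuel fails for a tuple independent mod ℚ̄ ⊕ ℚπi.
sources: Waldschmidt2000, Kirby2010EAEF, Lang1966, BaysKirby2018ANT
[crux] the exact complement (Factor 2): for x₁,…,x_n ∈ ℂ ℚ-linearly independent modulo V₂ =
span_ℚ(ℚ̄ ∪ {πi}) = ℚ̄ ⊕ ℚπi, the transcendence degree of K₂(x, e^x) over K₂ = ℚ(ℚ̄ ∪ {πi} ∪ e^ℚ̄)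
is at least n — Schanuel relative to the field of the π–LW sector (same shape as
LogPatterns.OffLogSector / AdelicLogSector.OffPrimeLogSector, with which it shares all tuples off
the log lattice). Implied by Schanuel (Exactness: finite-coefficient descent K₂ → ℚ(w, e^w) for a
finite-dimensional W ∋ πi, then Schanuel at (w, x) and the tower law, using trdeg ℚ(w, e^w) ≤ dim W
on V₂). [difficulty: open-problem] -/
@[route_item "route-Schanuel-ExceptionalSubspaces", crux]
def RelSchanuelOverPiLWField : Prop :=
  ∀ (n : ℕ) (x : Fin n → ℂ), LinearIndependent ℚ ((Submodule.span ℚ ({z : ℂ | IsAlgebraic ℚ z} ∪ {(Real.pi : ℂ) * Complex.I})).mkQ ∘ x) → (n : Cardinal) ≤ Algebra.trdeg ↥(IntermediateField.adjoin ℚ ({z : ℂ | IsAlgebraic ℚ z} ∪ {(Real.pi : ℂ) * Complex.I} ∪ Complex.exp '' {z : ℂ | IsAlgebraic ℚ z})) ↥(IntermediateField.adjoin ↥(IntermediateField.adjoin ℚ ({z : ℂ | IsAlgebraic ℚ z} ∪ {(Real.pi : ℂ) * Complex.I} ∪ Complex.exp '' {z : ℂ | IsAlgebraic ℚ z})) (Set.range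 x ∪ Set.range (Complex.exp ∘ x)))

/-- item stmt-Schanuel-9549 · crux · rank 6 · open · by planner
why it might fail: Via DefinabilityBridge it implies π ⊥ e^{∛2}, so it is at least a new transcendence theorem; no non-definability technique for ℂ_exp avoiding automorphisms exists (KMO p.2); false iff some α ∉ ℚ^{ab}∩ℝ (e.g. the real ∛2) has a parameter-free ∃-definition.
sources: arXiv:1101.4224, KirbyMacintyreOnshuus2012, Marker2006, Kirby2013FPEF
[crux] KMO's 'Theorem 2 for ℂ_exp', existential fragment (card C2): an algebraic number pointwise
definable in (ℂ, +, ·, exp) by an EXISTENTIAL formula without parameters is real-abelian (∈ ℚ^{ab} ∩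
ℝ). KMO prove Thm 1 (all real-abelian numbers ARE pointwise definable, in ℂ_exp too) and Thm 2 (the
converse) for Zilber fields, and name 'Theorem 2 for ℂ_exp' as the step towards Zilber's conjecture
they could not make 'even assuming Schanuel's Conjecture'. DefinabilityBridge converts it into π ⊥
e^α for all algebraic α with α² ∉ ℚ^{ab} ∩ ℝ — an alternative to GaloisOrbitRealised for the
symmetric part of the d = 1 layer and the transcendence price tag explaining its resistance.
[difficulty: open-problem] -/
@[route_item "route-Schanuel-ExceptionalSubspaces", crux]
def KMOTwoExistential : Prop :=
  ∀ a : ℂ, IsAlgebraic ℚ a → (∃ φ : Literature.ModelTheory.ExponentialFields.Language.expRing.Formula (Fin 1), FirstOrder.Language.BoundedFormula.IsExistential φ ∧ ∀ x : ℂ, φ.Realize ![x] ↔ x = a) → (a.im = 0 ∧ ∃ n : ℕ, 0 < n ∧ a ∈ IntermediateField.adjoin ℚ ({Complex.exp (2 * Real.pi * Complex.I / n)} : Set ℂ))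

/-- item stmt-Schanuel-9550 · support · rank 9 · closed · proved by Summit.Schanuel.Schanuel.Theorems.RigidCore.stub_endomorphismCriterion (prover) · by planner
sources: BakerTNT1975, doi:10.5802/jtnb.459, arXiv:1101.4224, Literature.NumberTheory.Transcendental.algebraicIndependent_exp_holds
[support] provable now (~400 lines over the tree's
`Literature.NumberTheory.Transcendental.algebraicIndependent_exp_holds` and
`transcendental_pi_holds`): if α is algebraic and a ring endomorphism j of ℂ with j ∘ exp = exp ∘ j
has jα ∉ {α, −α}, then π and e^α are algebraically independent. Proof: j(i) = ±i and e^{j(πi)} =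
j(−1) = −1 give j(π) = mπ with m odd; a relation P(π, e^α) = 0 over ℚ transports to P(mπ, e^{jα}) =
0, so e^α and e^{jα} are both algebraic over ℚ(π) (π, mπ transcendental ⇒ P(π,Y), P(mπ,Y) ≢ 0); if
(α, jα) is ℚ-free, LW makes e^α, e^{jα} algebraically independent — impossible inside trdeg 1; else
jα = qα with q ∈ ℚ∖{0, ±1} and the jⁿα = qⁿα are infinitely many roots of the minimal polynomial of
α. The LW-sector twin of RigidCore.EndomorphismMovingLogTwo. [difficulty: provable-now] -/
@[route_item "route-Schanuel-ExceptionalSubspaces", crux]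
def EndomorphismCriterion : Prop :=
  ∀ α : ℂ, IsAlgebraic ℚ α → ∀ j : ℂ →+* ℂ, (∀ z : ℂ, j (Complex.exp z) = Complex.exp (j z)) → j α ≠ α → j α ≠ -α → AlgebraicIndependent ℚ ![(Real.pi : ℂ), Complex.exp α]

/-- item stmt-Schanuel-9551 · support · rank 9 · closed · proved by Summit.Schanuel.Schanuel.Theorems.RigidCore.stub_conjugationOffAxes @ 827787eca931 (prover) · by planner
sources: doi:10.5802/jtnb.459, BakerTNT1975, Waldschmidt2000, Literature.NumberTheory.Transcendental.algebraicIndependent_exp_holds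
[support] THEOREM F2 of the card, provable now (~200 lines, LW + conj): for a transcendental η ∈ ℝ ∪
iℝ and an algebraic α with Re α ≠ 0 and Im α ≠ 0, η and e^α are algebraically independent
(instances: π ⊥ e^{1+i}; log 2 ⊥ e^{1+i}; trdeg ℚ(e^e, e^{1+i}) = trdeg ℚ(e^e) + 1). Proof: P(η,
e^α) = 0 conjugates to P(±η, e^{ᾱ}) = 0, so e^α, e^ᾱ are algebraic over ℚ(η), trdeg 1, while (α, ᾱ)
is ℚ-free and LW gives trdeg ℚ(e^α, e^ᾱ) = 2. Same Lean statement as card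
conjugation-discount-sigma-stable-core (R1) would file — filed once here (ledger dedup). At η = π it
is EndomorphismCriterion at j = conj (kernel-checked in the planner sketch). [difficulty:
provable-now] -/
@[route_item "route-Schanuel-ExceptionalSubspaces", crux]
def ConjugationOffAxes : Prop :=
  ∀ η α : ℂ, (η.im = 0 ∨ η.re = 0) → Transcendental ℚ η → IsAlgebraic ℚ α → α.re ≠ 0 → α.im ≠ 0 → AlgebraicIndependent ℚ ![η, Complex.exp α]

/-- item stmt-Schanuel-9552 · support · rank 9 · closed · proved by Summit.Schanuel.Schanuel.Theorems.RigidCore.stub_exceptionalLineDichotomy (prover) · by planner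
sources: BakerTNT1975, doi:10.5802/jtnb.459, Literature.NumberTheory.Transcendental.algebraicIndependent_exp_holds
[support] F1 of the card, provable now (~150 lines): for a transcendental anchor η and ℚ-linearly
independent algebraic α, β, at least one of the pairs (η, e^α), (η, e^β) is algebraically
independent — the exceptional exponents of an anchor span at most one ℚ-line (LW: e^α, e^β
algebraically independent cannot both be algebraic over ℚ(η)); the dimension-1 case of
ExceptionalSubspacesIntersect. At η = π, unconditionally: at least one of e ⊥ π, π ⊥ e^{√2}; at
least one of e ⊥ π, π ⊥ e^{i}. [difficulty: provable-now] -/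
@[route_item "route-Schanuel-ExceptionalSubspaces", crux]
def ExceptionalLineDichotomy : Prop :=
  ∀ η α β : ℂ, Transcendental ℚ η → IsAlgebraic ℚ α → IsAlgebraic ℚ β → LinearIndependent ℚ ![α, β] → AlgebraicIndependent ℚ ![η, Complex.exp α] ∨ AlgebraicIndependent ℚ ![η, Complex.exp β]

/-- `ExceptionalLineDichotomy` holds: proved by `Summit.Schanuel.Schanuel.Theorems.RigidCore.stub_exceptionalLineDichotomy`. -/
theorem ExceptionalLineDichotomy_holds : ExceptionalLineDichotomy := _root_.Summit.Schanuel.Schanuel.Theorems.RigidCore.stub_exceptionalLineDichotomy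

/-- item stmt-Schanuel-9553 · support · rank 9 · closed · proved by Summit.Schanuel.Schanuel.Theorems.RigidCore.SubspaceIntersect.exceptionalSubspacesIntersect (prover) · by planner
sources: BakerTNT1975, Lang1966, Literature.NumberTheory.Transcendental.algebraicIndependent_exp_holds
[support] the card's exceptional-SUBSPACE formalism as a theorem, provable now (M): for any η ∈ ℂ
and ℚ-subspaces A, B of ℚ̄ ⊂ ℂ, if η is algebraic over ℚ(e^A) and over ℚ(e^B) then η is algebraic
over ℚ(e^{A ∩ B}). Proof: extend a ℚ-basis of A ∩ B to bases of A and of B; the union is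
ℚ-independent in A + B, so by LW its exponentials form an algebraically independent set S ⊇ S_A, S_B
with S_A ∩ S_B = S_{A∩B}; ℚ(e^A) is algebraic over ℚ(S_A) (e^{qa} is a radical of e^a); and for
subsets of an algebraically independent set ℚ(S_A)^alg ∩ ℚ(S_B)^alg = ℚ(S_A ∩ S_B)^alg (exchange).
Consequences: if η is algebraic over the LW field there is a unique MINIMAL exceptional subspace A_η
(finite-dimensional), stable under conj when η ∈ ℝ ∪ iℝ and, for η = π, under the ℚ̄-action of every
ring endomorphism of ℂ commuting with exp (j(π) = mπ); PiFreeOverLWField ⟺ A_π does not exist; dim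
A_π = 1 is the regime of ExceptionalLineDichotomy / EndomorphismCriterion. [difficulty: M] -/
@[route_item "route-Schanuel-ExceptionalSubspaces", crux]
def ExceptionalSubspacesIntersect : Prop :=
  ∀ (η : ℂ) (A B : Submodule ℚ ℂ), (∀ z ∈ A, IsAlgebraic ℚ z) → (∀ z ∈ B, IsAlgebraic ℚ z) → IsAlgebraic ↥(IntermediateField.adjoin ℚ (Complex.exp '' (A : Set ℂ))) η → IsAlgebraic ↥(IntermediateField.adjoin ℚ (Complex.exp '' (B : Set ℂ))) η → IsAlgebraic ↥(IntermediateField.adjoin ℚ (Complex.exp '' ((A ⊓ B : Submodule ℚ ℂ) : Set ℂ))) η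

/-- item stmt-Schanuel-9554 · support · rank 9 · open · by planner
sources: arXiv:1101.4224, KirbyMacintyreOnshuus2012, BakerTNT1975
[support] provable now (L; first-order bookkeeping over Mathlib's
`FirstOrder.Language.BoundedFormula.IsExistential` / `Formula.Realize` and the tree's
`Language.expRing` structure on ℂ): KMOTwoExistential ⇒ π ⊥ e^α for every algebraic α with α² ∉
ℚ^{ab} ∩ ℝ. Proof (card F3): if P(π, e^{α₀}) = 0, the existential formula φ(a) := m_{α₀}(a) = 0 ∧ ∃z
∃w (E(z) + 1 = 0 ∧ w·w + 1 = 0 ∧ P(w·z, E(a)) = 0) holds of α₀ (z = πi, w = −i) and only of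
conjugates β with e^β algebraic over ℚ(π) (w·z = ±(2k+1)π is transcendental), hence by
ExceptionalLineDichotomy only of β ∈ ℚα₀ ∩ {conjugates of α₀} = {±α₀} (β = qα₀ conjugate ⇒ qⁿα₀
conjugates for all n ⇒ q = ±1); so ∃a (φ(a) ∧ x = a·a) is a parameter-free ∃-definition of α₀², and
KMOTwoExistential puts α₀² in ℚ^{ab} ∩ ℝ. [difficulty: L] -/
@[route_item "route-Schanuel-ExceptionalSubspaces", crux]
def DefinabilityBridge : Prop :=
  KMOTwoExistential → ∀ α : ℂ, IsAlgebraic ℚ α → ¬ ((α ^ 2).im = 0 ∧ ∃ n : ℕ, 0 < n ∧ α ^ 2 ∈ IntermediateField.adjoin ℚ ({Complex.exp (2 * Real.pi * Complex.I / n)} : Set ℂ)) → AlgebraicIndependent ℚ ![(Real.pi : ℂ), Complex.exp α]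

/-- item stmt-Schanuel-9555 · support · rank 9 · closed · proved by Summit.Schanuel.Schanuel.Theorems.RigidCore.EndoCriterion.dOneGlue (prover) · by planner
sources: arXiv:1101.4224, doi:10.5802/jtnb.459
[support] the d = 1 layer of PiFreeOverLWField from the two d = 1 cruxes, pure logic (kernel-checked
in the planner sketch, axioms propext / Classical.choice / Quot.sound): given EndomorphismCriterion,
GaloisOrbitRealised and RealAbelianResidue, π ⊥ e^α for every nonzero algebraic α (if α² is
real-abelian use the residue, else the realised orbit and the criterion). The Cardinal form '2 ≤
trdeg ℚ(π, e^α)' of the d = 1 instance is a later split glue. [difficulty: provable-now] -/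
@[route_item "route-Schanuel-ExceptionalSubspaces", crux]
def DOneGlue : Prop :=
  EndomorphismCriterion → GaloisOrbitRealised → RealAbelianResidue → ∀ α : ℂ, IsAlgebraic ℚ α → α ≠ 0 → AlgebraicIndependent ℚ ![(Real.pi : ℂ), Complex.exp α]

/-- item stmt-Schanuel-9556 · support · rank 9 · closed · proved by Summit.Schanuel.Schanuel.Theorems.RigidCore.stub_exactness @ f7a9eb132f61 (prover) · by planner
sources: Waldschmidt2000, Kirby2010EAEF, Literature.NumberTheory.Transcendental.schanuelConjecture_iff_ecl_empty_holds
[support] the factorisation loses nothing, provable now (L): Schanuel ⇒ PiFreeOverLWField (Schanuel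
at (πi, a₁,…,a_d), ℚ-free because π is transcendental; e^{πi} = −1 and i, a_j algebraic, so trdeg
ℚ(π, e^a) ≥ d + 1) and Schanuel ⇒ RelSchanuelOverPiLWField (if trdeg_{K₂} K₂(x, e^x) < n, the
finitely many algebraic dependences over K₂ have coefficients in ℚ(w, e^w) for a basis w of some
finite-dimensional W ⊂ V₂ containing πi; (w, x) is ℚ-free, Schanuel gives trdeg ℚ(w, x, e^w, e^x) ≥
dim W + n while trdeg ℚ(w, e^w) ≤ dim W on V₂ — tower law, contradiction). Hence X ⟺ Schanuel.
[difficulty: L] -/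
@[route_item "route-Schanuel-ExceptionalSubspaces", crux]
def Exactness : Prop :=
  Schanuel → PiFreeOverLWField ∧ RelSchanuelOverPiLWField

/-- `Exactness` holds: proved by `Summit.Schanuel.Schanuel.Theorems.RigidCore.stub_exactness` @ f7a9eb132f61. -/
theorem Exactness_holds : Exactness := _root_.Summit.Schanuel.Schanuel.Theorems.RigidCore.stub_exactness

/-- item stmt-Schanuel-9557 · assembly · rank 1 · closed · proved by Summit.Schanuel.Schanuel.Theorems.RigidCore.SectorGlue.gaussianStokesSector_assembly @ fdd69f32c02b (prover) · by planner
sources: Kirby2010EAEF, Waldschmidt2000, Literature.NumberTheory.Transcendental.schanuelConjecture_iff_ecl_empty_holds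
[assembly] PiFreeOverLWField → RelSchanuelOverPiLWField → Schanuel (GL_n(ℚ) split along V₂ = ℚ̄ ⊕
ℚπi + tower law + Lindemann–Weierstrass). -/
@[route_item "route-Schanuel-ExceptionalSubspaces", crux]
def Assembly : Prop :=
  PiFreeOverLWField → RelSchanuelOverPiLWField → Schanuel

/-- `Assembly` holds: proved by `Summit.Schanuel.Schanuel.Theorems.RigidCore.SectorGlue.gaussianStokesSector_assembly` @ fdd69f32c02b. -/
theorem Assembly_holds : Assembly := _root_.Summit.Schanuel.Schanuel.Theorems.RigidCore.SectorGlue.gaussianStokesSector_assembly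

/-! D-0027 §2.1 — DECIDING THEOREM (planner-authored via `route open/edit --closes-file`; by planner-plancard-Schanuel-Schanuel-exceptiona-7c4b660f-0 2026-08-15T14:01:00Z):
its hypotheses are this route's items and its conclusion the sub-problem Statement (glue_lint), and it elaborates with this file. -/

/-- D-0027 §2.1 deciding theorem of route ExceptionalSubspaces: hypotheses = the route's 13 items (5 cruxes, 7 supports,
the bookkeeping Assembly), conclusion = the sub-problem Statement `Schanuel`; the content is `Assembly` applied to the two factors
PiFreeOverLWField (the π–LW sector) and RelSchanuelOverPiLWField (its exact complement). -/
@[closes "route-Schanuel-ExceptionalSubspaces"] theorem closes (hAssembly : Assembly) (hPiFree : PiFreeOverLWField) (_hOrbit : GaloisOrbitRealised)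
    (_hResidue : RealAbelianResidue) (hRel : RelSchanuelOverPiLWField) (_hKMO : KMOTwoExistential)
    (_hCriterion : EndomorphismCriterion) (_hConj : ConjugationOffAxes) (_hDichotomy : ExceptionalLineDichotomy)
    (_hIntersect : ExceptionalSubspacesIntersect) (_hBridge : DefinabilityBridge) (_hGlue : DOneGlue)
    (_hExact : Exactness) : _root_.Schanuel :=
  hAssembly hPiFree hRel

end Summit.Schanuel.Schanuel.Theses.ExceptionalSubspaces
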